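import Summits.QuantumAdvantage.QuantumAdvantage.Theorems.PairFreezingD

/-! # PairFreezingE — part 5/8 (mechanical split for landing of `PairFreezing`; content verbatim; scopes re-opened with their variables) -/

set_option linter.dupNamespace false -- D-0017: single-problem summit ⇒ `QuantumAdvantage.QuantumAdvantage` by design
noncomputable section

namespace Summit.QuantumAdvantage.QuantumAdvantage.Theorems.PairFreezing
open Classical Finset Summit.QuantumAdvantage.AdviceFreeQNC0
open Literature.Computability.MetaComplexity Literature.Computability.MetaComplexity.Smolensky
open Literature.Computability.Complexity (parityFn)
open Summit.QuantumAdvantage.QuantumAdvantage.Theses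
open Summit.QuantumAdvantage.AdviceFreeQNC0.TransferWalk (wtPrefix_zero)
variable {n : ℕ}

namespace Pairing
variable (π : Pairing n)

section Occupation
variable (tab : Fin (n + 1) → Bool)


/-- the occupation bound over `ℝ`: `#{u : #Rel(u) < M} ≤ 3 · 2^M · (7/8)^K · 2ⁿ`. -/
theorem occupation_real (c M : ℕ) :
    ((univ.filter fun u : Fin n → Bool => decide ((π.rel c tab u).card < M) = true).card : ℝ) ≤
      3 * 2 ^ M * (7 / 8 : ℝ) ^ π.K tab * 2 ^ n := by
  have h := π.occupation tab c M
  have hset : (univ.filter fun u : Fin n → Bool => decide ((π.rel c tab u).card < M) = true) =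
      univ.filter fun u : Fin n → Bool => (π.rel c tab u).card < M := by
    ext u; simp only [mem_filter, mem_univ, true_and, decide_eq_true_eq]
  rw [hset]
  have hr : ((univ.filter fun u : Fin n → Bool => (π.rel c tab u).card < M).card : ℝ) * 32 ^ π.K tab ≤
      3 * (2 ^ M * 28 ^ π.K tab * 2 ^ n) := by exact_mod_cast h
  have h32 : (0 : ℝ) < 32 ^ π.K tab := by positivity
  have hkey : (3 : ℝ) * (2 ^ M * 28 ^ π.K tab * 2 ^ n) = (3 * 2 ^ M * (7 / 8 : ℝ) ^ π.K tab * 2 ^ n) * 32 ^ π.K tab := by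
    have : (28 : ℝ) ^ π.K tab = (7 / 8 : ℝ) ^ π.K tab * 32 ^ π.K tab := by
      rw [← mul_pow]; norm_num
    rw [this]; ring
  rw [hkey] at hr
  exact le_of_mul_le_mul_right hr h32

end Occupation
end Pairing


/-! ### §5 The dense-table law `DenseLoseHalfF p` — a THEOREM for every odd prime

Inside every polylog-degree `𝔽_p` level set `U = {g = true}`, every fixed firing table with at least `(log₂ L)^{2C+1}`
fired cuts LOSES the u-walk game on at least `½·#U − δ·2^L` inputs. -/

/-- the two standard pairings of `{0,1}^L`: offset `0` (pairs `(2i, 2i+1)`) and offset `1` (pairs `(2i+1, 2i+2)`). -/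
def pairing0 (L : ℕ) : Pairing L := ⟨0, L / 2, by omega⟩
/-- Pair-freezing helper `pairing1` (lens-4 g4 machinery; see the enclosing section docstring). -/
def pairing1 (L : ℕ) (hL : 1 ≤ L) : Pairing L := ⟨1, (L - 1) / 2, by omega⟩

/-- every fired cut other than the two end cuts is the middle cut of a pair of one of the two standard pairings. -/
theorem card_fired_le_two_add (L : ℕ) (hL : 1 ≤ L) (tab : Fin (L + 1) → Bool) :
    (univ.filter fun h : Fin (L + 1) => tab h = true).card ≤
      2 + (pairing0 L).t tab + (pairing1 L hL).t tab := by
  have hsub : (univ.filter fun h : Fin (L + 1) => tab h = true) ⊆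
      insert (0 : Fin (L + 1)) (insert (Fin.last L)
        (((pairing0 L).spec tab).image (pairing0 L).mid ∪ ((pairing1 L hL).spec tab).image (pairing1 L hL).mid)) := by
    intro h hh
    rw [mem_filter] at hh
    rw [mem_insert, mem_insert, mem_union, mem_image, mem_image]
    by_cases h0 : h = 0
    · exact Or.inl h0
    by_cases hLst : h = Fin.last L
    · exact Or.inr (Or.inl hLst)
    have hv0 : h.val ≠ 0 := fun e => h0 (Fin.ext e)
    have hvL : h.val ≠ L := fun e => hLst (Fin.ext e)
    have hlt := h.isLt
    refine Or.inr (Or.inr ?_)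
    rcases Nat.even_or_odd h.val with ⟨r, hr⟩ | ⟨r, hr⟩
    · -- even, `h = 2r`, `r ≥ 1`: middle cut of pair `r - 1` of offset 1
      refine Or.inr ⟨⟨r - 1, by show r - 1 < (L - 1) / 2; omega⟩, ?_, ?_⟩
      · unfold Pairing.spec; rw [mem_filter]
        refine ⟨mem_univ _, ?_⟩
        have : (pairing1 L hL).mid ⟨r - 1, by show r - 1 < (L - 1) / 2; omega⟩ = h :=
          Fin.ext (by simp [Pairing.mid, pairing1]; omega)
        rw [this]; exact hh.2
      · exact Fin.ext (by simp [Pairing.mid, pairing1]; omega)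
    · -- odd, `h = 2r+1`: middle cut of pair `r` of offset 0
      refine Or.inl ⟨⟨r, by show r < L / 2; omega⟩, ?_, ?_⟩
      · unfold Pairing.spec; rw [mem_filter]
        refine ⟨mem_univ _, ?_⟩
        have : (pairing0 L).mid ⟨r, by show r < L / 2; omega⟩ = h :=
          Fin.ext (by simp [Pairing.mid, pairing0]; omega)
        rw [this]; exact hh.2
      · exact Fin.ext (by simp [Pairing.mid, pairing0]; omega)
  refine (card_le_card hsub).trans ?_
  refine (card_insert_le _ _).trans ?_
  rw [show 2 + (pairing0 L).t tab + (pairing1 L hL).t tab = ((pairing0 L).t tab + (pairing1 L hL).t tab + 1) + 1 by ring]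
  refine Nat.add_le_add_right ((card_insert_le _ _).trans (Nat.add_le_add_right ?_ _)) _
  refine (card_union_le _ _).trans (Nat.add_le_add ?_ ?_)
  · exact card_image_le.trans le_rfl
  · exact card_image_le.trans le_rfl

/-- **`DenseLoseHalfF p`** — the dense-table level-set law (η = ½, polylog threshold).  Hypothesis-side in shape, but
PROVED below for every odd prime. -/
def DenseLoseHalfF (p : ℕ) [Fact p.Prime] : Prop :=
  ∀ C : ℕ, ∀ δ : ℝ, 0 < δ → ∃ A L₀ : ℕ, ∀ L ≥ L₀, ∀ (c : ℕ) (tab : Fin (L + 1) → Bool)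
    (g : (Fin L → Bool) → Bool), HasDegF p g ((Nat.log 2 L) ^ C) →
      (Nat.log 2 L) ^ A ≤ (univ.filter fun h : Fin (L + 1) => tab h = true).card →
      (1 / 2 : ℝ) * ((univ.filter fun z : Fin L → Bool => g z = true).card : ℝ)
        ≤ ((univ.filter fun z : Fin L → Bool => g z = true ∧ ringWinU c (fun h _ => tab h) z = false).card : ℝ)
          + δ * (2 : ℝ) ^ L

/-- **THEOREM (pair freezing).** `DenseLoseHalfF p` holds for every odd prime `p`. -/
theorem denseLoseHalfF_holds (p : ℕ) [Fact p.Prime] (hp2 : p ≠ 2) : DenseLoseHalfF p := by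
  intro C δ hδ
  have h2 : (2 : ZMod p) ≠ 0 := (by
    intro h0
    have h0' : ((2 : ℕ) : ZMod p) = 0 := by exact_mod_cast h0
    rw [ZMod.natCast_eq_zero_iff] at h0'
    exact hp2 ((Nat.prime_dvd_prime_iff_eq Fact.out Nat.prime_two).1 h0'))
  -- constants
  obtain ⟨m₀, hm₀, hm₀1⟩ : ∃ m₀ : ℕ, 1 / δ ^ 2 ≤ (m₀ : ℝ) ∧ 1 ≤ m₀ :=
    ⟨⌈1 / δ ^ 2⌉₊ + 1, (Nat.le_ceil _).trans (by push_cast; linarith), by omega⟩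
  obtain ⟨E, hE⟩ : ∃ E : ℕ, 3 / δ ≤ (2 : ℝ) ^ E := by
    obtain ⟨E, hE⟩ := pow_unbounded_of_one_lt (3 / δ) (by norm_num : (1 : ℝ) < 2)
    exact ⟨E, hE.le⟩
  refine ⟨2 * C + 1, 2 ^ (24 * m₀ + 24 * E + 8), fun L hL c tab g hg hS => ?_⟩
  -- sizes
  set ℓ := Nat.log 2 L with hℓ
  have hℓge : 24 * m₀ + 24 * E + 8 ≤ ℓ := by
    rw [hℓ]; exact Nat.le_log_of_pow_le (by norm_num) hL
  have hL1 : 1 ≤ L := le_trans Nat.one_le_two_pow hL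
  set X := ℓ ^ (2 * C) with hX
  have hX1 : 1 ≤ X := Nat.one_le_pow _ _ (by omega)
  set M := X * m₀ with hMdef
  have hM1 : 1 ≤ M := Nat.one_le_iff_ne_zero.2 (Nat.mul_ne_zero (by omega) (by omega))
  -- fired cuts: at least `24 (M + E) + 8`
  have hSge : 24 * (M + E) + 8 ≤ (univ.filter fun h : Fin (L + 1) => tab h = true).card := by
    have hpow : X * ℓ = ℓ ^ (2 * C + 1) := by rw [hX, pow_succ]
    have h1 : X * (24 * m₀ + 24 * E + 8) ≤ X * ℓ := Nat.mul_le_mul_left _ hℓge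
    rw [hpow] at h1
    have h3 : X * (24 * m₀ + 24 * E + 8) = 24 * (X * m₀) + 24 * (X * E) + X * 8 := by ring
    have h4 : E ≤ X * E := Nat.le_mul_of_pos_left E hX1
    have h5 : ℓ ^ (2 * C + 1) ≤ (univ.filter fun h : Fin (L + 1) => tab h = true).card := hS
    omega
  -- choose the better of the two standard pairings
  obtain ⟨π, hπ⟩ : ∃ π : Pairing L, (univ.filter fun h : Fin (L + 1) => tab h = true).card ≤ 2 + 2 * π.t tab := by
    have hcov := card_fired_le_two_add L hL1 tab
    by_cases h01 : (pairing1 L hL1).t tab ≤ (pairing0 L).t tab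
    · exact ⟨pairing0 L, by omega⟩
    · exact ⟨pairing1 L hL1, by omega⟩
  have hK : 6 * (M + E) ≤ π.K tab := by
    unfold Pairing.K; omega
  -- the two inequalities
  have hcore := π.core_half c tab h2 hg hM1
  have hocc := π.occupation_real tab c M
  have h2L : (0 : ℝ) < (2 : ℝ) ^ L := by positivity
  -- error term 1: `D/√M ≤ δ`
  have herr1 : ((ℓ ^ C : ℕ) : ℝ) / Real.sqrt M ≤ δ := by
    have hMr : (M : ℝ) = ((ℓ ^ C : ℕ) : ℝ) ^ 2 * m₀ := by
      rw [hMdef, hX]; push_cast; ring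
    have hMge : (((ℓ ^ C : ℕ) : ℝ)) ^ 2 ≤ δ ^ 2 * M := by
      rw [hMr]
      have hD0 : (0 : ℝ) ≤ (((ℓ ^ C : ℕ) : ℝ)) ^ 2 := by positivity
      have hdm : (1 : ℝ) ≤ δ ^ 2 * m₀ := by
        have hδ2 : (0 : ℝ) < δ ^ 2 := by positivity
        calc (1 : ℝ) = δ ^ 2 * (1 / δ ^ 2) := by field_simp
          _ ≤ δ ^ 2 * m₀ := mul_le_mul_of_nonneg_left hm₀ hδ2.le
      nlinarith
    have hsq : (((ℓ ^ C : ℕ) : ℝ)) ≤ δ * Real.sqrt M := by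
      have h := Real.sqrt_le_sqrt hMge
      rw [Real.sqrt_sq (by positivity), Real.sqrt_mul (by positivity), Real.sqrt_sq hδ.le] at h
      exact h
    have hMpos : (0 : ℝ) < Real.sqrt M := Real.sqrt_pos.2 (by exact_mod_cast hM1)
    rw [div_le_iff₀ hMpos]
    exact hsq
  -- error term 2: `3·2^M·(7/8)^K ≤ δ`
  have herr2 : 3 * 2 ^ M * (7 / 8 : ℝ) ^ π.K tab ≤ δ := by
    have h78 : (7 / 8 : ℝ) ^ π.K tab ≤ (7 / 8 : ℝ) ^ (6 * (M + E)) :=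
      pow_le_pow_of_le_one (by norm_num) (by norm_num) hK
    have h6 : (7 / 8 : ℝ) ^ (6 * (M + E)) ≤ (1 / 2 : ℝ) ^ (M + E) := by
      rw [pow_mul]
      exact pow_le_pow_left₀ (by norm_num) (by norm_num) _
    have hhalf : (3 : ℝ) * 2 ^ M * (1 / 2 : ℝ) ^ (M + E) = 3 / 2 ^ E := by
      rw [pow_add, one_div_pow, one_div_pow]
      field_simp
    have hfin : (3 : ℝ) / 2 ^ E ≤ δ := by
      rw [div_le_iff₀ (by positivity)]
      have := (div_le_iff₀ hδ).1 hE
      linarith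
    have h2M : (0 : ℝ) ≤ 3 * 2 ^ M := by positivity
    calc 3 * 2 ^ M * (7 / 8 : ℝ) ^ π.K tab ≤ 3 * 2 ^ M * (1 / 2 : ℝ) ^ (M + E) :=
          mul_le_mul_of_nonneg_left (h78.trans h6) h2M
      _ = 3 / 2 ^ E := hhalf
      _ ≤ δ := hfin
  -- the split of `U`
  have hsplit : ((univ.filter fun z : Fin L → Bool => g z = true).card : ℝ) =
      (univ.filter fun z : Fin L → Bool => (g z && ringWinU c (fun h _ => tab h) z) = true).card
      + (univ.filter fun z : Fin L → Bool => g z = true ∧ ringWinU c (fun h _ => tab h) z = false).card := by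
    rw [← Nat.cast_add, ← card_union_of_disjoint]
    · refine congrArg _ (congrArg Finset.card ?_)
      ext u
      simp only [mem_union, mem_filter, mem_univ, true_and]
      cases g u <;> cases ringWinU c (fun h _ => tab h) u <;> simp
    · refine disjoint_filter.2 fun u _ h1 h3 => ?_
      revert h1 h3
      cases g u <;> cases ringWinU c (fun h _ => tab h) u <;> simp
  -- assemble
  have hA : (1 / 2 : ℝ) * ((((ℓ ^ C : ℕ) : ℝ) / Real.sqrt M) * 2 ^ L) ≤ (1 / 2) * (δ * 2 ^ L) := by
    refine mul_le_mul_of_nonneg_left (mul_le_mul_of_nonneg_right herr1 h2L.le) (by norm_num)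
  have hB : (1 / 2 : ℝ) * ((univ.filter fun u : Fin L → Bool =>
      decide ((π.rel c tab u).card < M) = true).card : ℝ) ≤ (1 / 2) * (δ * 2 ^ L) := by
    refine mul_le_mul_of_nonneg_left (hocc.trans ?_) (by norm_num)
    exact mul_le_mul_of_nonneg_right herr2 h2L.le
  have hcore' : ((univ.filter fun u : Fin L → Bool => (g u && ringWinU c (fun h _ => tab h) u) = true).card : ℝ) ≤
      (1 / 2) * ((univ.filter fun u : Fin L → Bool => g u = true).card : ℝ)
        + (1 / 2) * ((((ℓ ^ C : ℕ) : ℝ) / Real.sqrt M) * 2 ^ L)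
        + (1 / 2) * ((univ.filter fun u : Fin L → Bool =>
            decide ((π.rel c tab u).card < M) = true).card : ℝ) := by
    have h := hcore
    simp only [Nat.cast_pow] at h ⊢
    exact h
  linarith


end Summit.QuantumAdvantage.QuantumAdvantage.Theorems.PairFreezing
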